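import Summits.BirchSwinnertonDyer.Rank1Residual.GaloisImage.InertiaInvariantsFrobeniusKernel
import Literature.NumberTheory.EllipticCurves.PeriodIndexFrobeniusTorsion
import Literature.NumberTheory.EllipticCurves.NeronOggShafarevichLocal
import HarnessLib

/-!
# `H¹_ur(K_v, E[p^∞]) = 0` at a place `v ∤ p` where the inertia-fixed `p`-power torsion
# `E[p^∞]^{I_v}` is `p`-DIVISIBLE (team n1011, row T-GP6, seat p10 GEN 11, FILE 1b — TOOL)

HONEST FRAMING (cell `b2b-bsdres-*`, team n1011, verbatim): prove what is provable now; shrink each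
hard class to its core with data; no claim beyond stated classes. Research route; TOOL theorems
only — no definition, no named fact, nothing booked, no residual-map mark moved, no class closed.

## What

Row T-GP6 discharges the named fact `GrossParson2011.lemma6_kummerSelmerStructure_eq_unramifiedSubgroup`
(Gross–Parson 2012, Lemma 6, case `R₀ = ℤ`: at a finite place `v ∤ p` with `p ∤ #Φ_v(k̄)` the local
Kummer condition of `E[p]` IS `H¹_ur(K_v, E[p])`).  The tree has the GOOD case (`#Φ_v = 1`):
`X11b.LocBridge.unramifiedSubgroup_primary_eq_bot` (`H¹_ur(K_v, E[p^∞]) = 0`), resting on "the inertia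
group acts TRIVIALLY on `E[p^∞]`" (Silverman VII.4.1).  This file re-proves it under the ONE
hypothesis that replaces good reduction in Gross–Parson's lemma:

  (DIV)  every `I_v`-fixed point of `E(K̄)[p^∞]` is `p` times an `I_v`-fixed point of `E(K̄)[p^∞]`

(`I_v = absInertia K_v` acting through `res : Γ_{K_v} → Γ_K`, or `I_{𝔓₀}` of the chosen prime —
the same thing, FILE 1a; equivalently `E(K_v^nr)[p^∞]` is `p`-divisible, true iff
`p ∤ #Φ_v(k̄) · char k_v`, FILES 3–4 of the row).

* §1 `exists_frob_smul_sub_eq_of_inertiaDivisible` — at `v ∤ p` under (DIV), `φ − 1` is onto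
  `N = E[p^∞]^{I_{𝔓₀}}` for an arithmetic Frobenius `φ` at `𝔓₀`: `N` is `p`-divisible, `N[pⁿ] ⊆ E[pⁿ]`
  is finite of `p`-power order, `φ − 1` preserves `N` and its kernel there consists of `D_{𝔓₀}`-fixed
  points, a finite set (FILE 1a) — the tree's counting lemma `exists_eq_of_finite_ker`.
* §2 `resOfLe_inertia_injective_of_inertiaDivisible` — **`H¹(D_v, E[p^∞]) ↪ H¹(I_v, E[p^∞])`** under
  (DIV) (FILE 1a §1 with `I = I_{𝔓₀}`, `D = D_{𝔓₀}`; the tree's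
  `AcSelmer.resOfLe_inertia_injective_of_hasGoodReductionAt` is the good case).
* §3 `unramifiedSubgroup_primary_eq_bot_of_inertiaDivisible` — **`unramifiedSubgroup (E[p^∞]|_{Γ_{K_v}}) 1 = ⊥`**
  under (DIV): a class unramified in `H¹(Γ_{K_v}, E[p^∞])` is principal on `I_{K_v}`
  (`LocBridge.mem_unramifiedSubgroup_one_iff_exists`), hence represented by a cocycle VANISHING on
  `I_{K_v}`; it descends to `D_v` (`LocBridge.oneCocycleClass_eq_zero_of_descent`) and dies by §2.
* §4 (DIV) from LOCAL data: `inertiaDivisible_of_localPoints` — if every `absInertia K_v`-fixed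
  `p`-power torsion point of `E(K̄_v)` is `p` times such a point, then (DIV) (torsion of `E(K̄_v)` is
  algebraic, `exists_pointsMapOfEmb_eq_of_nsmul_eq_zero`; equivariance `pointsMap_smul`); and the good
  case: (DIV) holds at good `v ∤ p`, so the tree's theorem is re-derived
  (`unramifiedSubgroup_primary_eq_bot_of_hasGoodReductionAt'`).

References: [GrossParson2011] Lemma 6 (p. 226); [MilneADT2006] I §2, Prop. I.3.8;
[GreenbergLNM1716] §3 Lemma 3.3 (pp. 86–88); [SerreGaloisCohomology1997] I §2.6 (b), I §5;
[NeukirchANT1999] I §9 (9.4), II §9 (9.6); [SilvermanAEC2009] VII.4.1, III.6.4.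
-/

noncomputable section

open scoped Classical Topology Pointwise

open NumberField IsDedekindDomain Field
open Literature.NumberTheory.EllipticCurves Literature.NumberTheory.EllipticCurves.GreenbergSelmer
open Literature.NumberTheory.GaloisRepresentations IsDedekindDomain.HeightOneSpectrum
open Literature.NumberTheory.GaloisRepresentations.IsNonarchimedeanLocalField

universe u

namespace Summit.BirchSwinnertonDyer.Rank1Residual.GaloisImage.InertiaDivisible

open Summit.BirchSwinnertonDyer.Rank1Residual.X11b.AcSelmer
open Summit.BirchSwinnertonDyer.Rank1Residual.X11b.LocBridge

section Curve

variable {K : Type} [Field K] [NumberField K] (E : WeierstrassCurve K) [E.IsElliptic]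
  (p : ℕ) [Fact p.Prime]

/-! ## §1. `φ − 1` is onto `E[p^∞]^{I_v}` when `E[p^∞]^{I_v}` is `p`-divisible (`v ∤ p`) -/

/-- **At `v ∤ p`, if `E[p^∞]^{I_v}` is `p`-divisible then `φ − 1` is ONTO `E[p^∞]^{I_v}`** for an
arithmetic Frobenius `φ` at the chosen prime `𝔓₀ ∣ v`.  `N = E[p^∞]^{I_{𝔓₀}}` is `p`-divisible by
hypothesis, `N[pⁿ] ⊆ E[pⁿ]` is finite of `p`-power order, `φ − 1` preserves `N` (`I` is normalised
by `φ`) and its kernel on `N` consists of `D_{𝔓₀}`-fixed points, a finite set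
(`finite_setOf_forall_decompositionSubgroup_smul_eq`); the tree's counting lemma
`exists_eq_of_finite_ker` concludes.  (The good case is the tree's `AcSelmer.exists_frob_smul_sub_eq`.)
[cite: GreenbergLNM1716, §3 Lemma 3.3 (proof, p. 87)] [cite: MilneADT2006, Ch. I §2 (unramified cohomology)] -/
theorem exists_frob_smul_sub_eq_of_inertiaDivisible {v : HeightOneSpectrum (𝓞 K)}
    (hpv : (p : 𝓞 K) ∉ v.asIdeal)
    (hdiv : ∀ t : E.geomPrimaryTorsion p,
      (∀ i ∈ (adicCompletionPrime K v).inertia (absoluteGaloisGroup K), i • t = t) →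
      ∃ s : E.geomPrimaryTorsion p,
        (∀ i ∈ (adicCompletionPrime K v).inertia (absoluteGaloisGroup K), i • s = s) ∧ p • s = t)
    {φ : absoluteGaloisGroup K} (hφ : IsArithFrobAt (𝓞 K) φ (adicCompletionPrime K v))
    (m : E.geomPrimaryTorsion p)
    (hm : ∀ i ∈ (adicCompletionPrime K v).inertia (absoluteGaloisGroup K), i • m = m) :
    ∃ b : E.geomPrimaryTorsion p,
      (∀ i ∈ (adicCompletionPrime K v).inertia (absoluteGaloisGroup K), i • b = b) ∧ φ • b - b = m := by
  set I : Subgroup (absoluteGaloisGroup K) := (adicCompletionPrime K v).inertia (absoluteGaloisGroup K)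
    with hIdef
  have hφD : φ ∈ (adicCompletionPrime K v).decompositionSubgroup (absoluteGaloisGroup K) :=
    hφ.mem_stabilizer
  -- the subgroup `N = E[p^∞]^I`
  let N : AddSubgroup (E.geomPrimaryTorsion p) :=
    { carrier := {x | ∀ i ∈ I, i • x = x}
      add_mem' := fun {a b} ha hb i hi ↦ by rw [smul_add, ha i hi, hb i hi]
      zero_mem' := fun i _ ↦ smul_zero i
      neg_mem' := fun {a} ha i hi ↦ by rw [smul_neg, ha i hi] }
  have hNmem : ∀ x : E.geomPrimaryTorsion p, x ∈ N ↔ ∀ i ∈ I, i • x = x := fun _ ↦ Iff.rfl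
  -- `φ − 1` preserves `N`
  have hφN : ∀ x : E.geomPrimaryTorsion p, x ∈ N → φ • x ∈ N := by
    intro x hx i hi
    have hi' : φ⁻¹ * i * φ ∈ I := inv_mul_mul_mem_inertia_adicCompletionPrime v hφD hi
    have e : i • φ • x = φ • ((φ⁻¹ * i * φ) • x) := by
      rw [← mul_smul, ← mul_smul]; congr 1; group
    rw [e, hx _ hi']
  let f : N →+ N :=
    { toFun := fun x ↦ ⟨φ • (x : E.geomPrimaryTorsion p) - x, N.sub_mem (hφN _ x.2) x.2⟩
      map_zero' := Subtype.ext (by simp)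
      map_add' := fun a b ↦ Subtype.ext (by
        simp only [AddSubgroup.coe_add, AddMemClass.mk_add_mk, smul_add]; abel) }
  have hf : ∀ x : N, ((f x : N) : E.geomPrimaryTorsion p) = φ • (x : E.geomPrimaryTorsion p) - x :=
    fun _ ↦ rfl
  -- (i) `N` is `p`-divisible
  have hdivN : ∀ a : N, ∃ b : N, p • b = a := by
    intro a
    obtain ⟨s, hs, hps⟩ := hdiv a a.2
    exact ⟨⟨s, hs⟩, Subtype.ext hps⟩
  -- (ii) `N[p^k]` is finite, of `p`-power order
  have hinj : ∀ k : ℕ, ∃ g : AddSubgroup.torsionBy N (p ^ k : ℕ) →+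
      AddSubgroup.torsionBy (E.geomPoints) (p ^ k : ℕ), Function.Injective g := by
    intro k
    refine ⟨{ toFun := fun x ↦ ⟨(((x : N) : E.geomPrimaryTorsion p) : E.geomPoints), ?_⟩
              map_zero' := Subtype.ext rfl
              map_add' := fun a b ↦ Subtype.ext rfl }, ?_⟩
    · have hx := AddSubgroup.torsionBy.nsmul_iff.mp x.2
      rw [AddSubgroup.torsionBy.nsmul_iff]
      have h1 := congrArg (fun z : N ↦ ((z : E.geomPrimaryTorsion p) : E.geomPoints)) hx
      simpa only [AddSubmonoidClass.coe_nsmul, ZeroMemClass.coe_zero] using h1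
    · intro a b hab
      have h := congrArg (fun z : AddSubgroup.torsionBy (E.geomPoints) (p ^ k : ℕ) ↦
        (z : E.geomPoints)) hab
      exact Subtype.ext (Subtype.ext (Subtype.ext h))
  have hcardE : ∀ k : ℕ, Nat.card (AddSubgroup.torsionBy (E.geomPoints) (p ^ k : ℕ)) = p ^ (2 * k) :=
    fun k ↦ by
      rw [pow_mul']
      exact WeierstrassCurve.card_torsionPoints_eq_sq_holds E (AlgebraicClosure K)
        (by exact_mod_cast pow_ne_zero k (Fact.out : p.Prime).ne_zero)
  have hfinE : ∀ k : ℕ, Finite (AddSubgroup.torsionBy (E.geomPoints) (p ^ k : ℕ)) := fun k ↦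
    Nat.finite_of_card_ne_zero (by rw [hcardE k]; exact pow_ne_zero _ (Fact.out : p.Prime).ne_zero)
  have hfinN : ∀ k : ℕ, (AddSubgroup.torsionBy N (p ^ k : ℕ) : Set N).Finite := by
    intro k
    obtain ⟨g, hg⟩ := hinj k
    haveI := hfinE k
    exact Set.finite_coe_iff.mp (Finite.of_injective g hg)
  have hcardN : ∀ k : ℕ, ∃ e : ℕ, Nat.card (AddSubgroup.torsionBy N (p ^ k : ℕ)) = p ^ e := by
    intro k
    obtain ⟨g, hg⟩ := hinj k
    have hdvd : Nat.card (AddSubgroup.torsionBy N (p ^ k : ℕ)) ∣ p ^ (2 * k) := by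
      rw [← hcardE k]
      exact AddSubgroup.card_dvd_of_injective g hg
    obtain ⟨e, -, he⟩ := (Nat.dvd_prime_pow (Fact.out : p.Prime)).mp hdvd
    exact ⟨e, he⟩
  -- (iii) the kernel of `φ − 1` on `N` is finite (`D_{𝔓₀}`-fixed points)
  have hker : {a : N | a ∈ AddCommGroup.primaryComponent N p ∧ f a = 0}.Finite := by
    have hsub : (fun a : N ↦ (a : E.geomPrimaryTorsion p)) ''
        {a : N | a ∈ AddCommGroup.primaryComponent N p ∧ f a = 0} ⊆
        {t : E.geomPrimaryTorsion p |
          ∀ d ∈ (adicCompletionPrime K v).decompositionSubgroup (absoluteGaloisGroup K), d • t = t} := by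
      rintro _ ⟨a, ⟨-, ha⟩, rfl⟩ d hd
      have hφa : φ • (a : E.geomPrimaryTorsion p) = a := by
        have h := congrArg (fun z : N ↦ (z : E.geomPrimaryTorsion p)) ha
        simp only [hf, ZeroMemClass.coe_zero] at h
        exact sub_eq_zero.mp h
      exact smul_eq_of_mem_decompositionSubgroup_of_inertia_of_frob E p v hφ a.2 hφa hd
    exact Set.Finite.of_finite_image
      ((finite_setOf_forall_decompositionSubgroup_smul_eq E p hpv).subset hsub)
      (Subtype.val_injective.injOn)
  -- (iv) `m ∈ N[p^∞] = N`
  have hmN : (⟨m, hm⟩ : N) ∈ AddCommGroup.primaryComponent N p := by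
    obtain ⟨k, hk⟩ := (AddCommGroup.mem_primaryComponent).mp m.2
    have hk' : p ^ k • m = 0 :=
      Subtype.ext (by rw [AddSubmonoidClass.coe_nsmul, ZeroMemClass.coe_zero]; exact hk)
    exact (AddCommGroup.mem_primaryComponent).mpr ⟨k,
      Subtype.ext (by rw [AddSubmonoidClass.coe_nsmul, ZeroMemClass.coe_zero]; exact hk')⟩
  obtain ⟨z, -, hz⟩ := exists_eq_of_finite_ker hdivN hfinN hcardN f hker hmN
  refine ⟨z, z.2, ?_⟩
  have h := congrArg (fun w : N ↦ (w : E.geomPrimaryTorsion p)) hz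
  simpa only [hf] using h

/-! ## §2. `H¹(D_v, E[p^∞]) ↪ H¹(I_v, E[p^∞])` under (DIV) -/

/-- **`res : H¹(D_v, E[p^∞]) → H¹(I_v, E[p^∞])` is injective at `v ∤ p` when `E[p^∞]^{I_v}` is
`p`-divisible** — equivalently `H¹_ur(K_v, E[p^∞]) = E[p^∞]^{I_v}/(Frob_v − 1) = 0` (Milne *ADT* I §2;
Greenberg LNM 1716 Lemma 3.3 at a place with `p ∤ c_v`).  From §1 with `I = I_{𝔓₀}`, `D = D_{𝔓₀}`
(generation: `exists_eq_frobenius_pow_mul_of_mem_decompositionSubgroup`; normality: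
`inv_mul_mul_mem_inertia_adicCompletionPrime`; `φ − 1` onto `E[p^∞]^I`: §2).  The tree's
`AcSelmer.resOfLe_inertia_injective_of_hasGoodReductionAt` is the good case.
[cite: GreenbergLNM1716, §3 Lemma 3.3 (pp. 86–88)] [cite: MilneADT2006, Ch. I §2 (unramified cohomology)] -/
theorem resOfLe_inertia_injective_of_inertiaDivisible {v : HeightOneSpectrum (𝓞 K)}
    (hpv : (p : 𝓞 K) ∉ v.asIdeal)
    (hdiv : ∀ t : E.geomPrimaryTorsion p,
      (∀ i ∈ (adicCompletionPrime K v).inertia (absoluteGaloisGroup K), i • t = t) →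
      ∃ s : E.geomPrimaryTorsion p,
        (∀ i ∈ (adicCompletionPrime K v).inertia (absoluteGaloisGroup K), i • s = s) ∧ p • s = t) :
    Function.Injective
      (resOfLe (E.geomPrimaryTorsion p) (inertia_adicCompletionPrime_le_decomp v)) := by
  have h𝔓₀ := adicCompletionPrime_mem_primesAbove K v
  have e : decomp v = (adicCompletionPrime K v).decompositionSubgroup (absoluteGaloisGroup K) := by
    rw [decompositionSubgroup_adicCompletionPrime_eq_range]; rfl
  obtain ⟨φ, hφ⟩ := exists_isArithFrobAt_of_mem_primesAbove_holds h𝔓₀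
  have hφD : φ ∈ decomp v := by rw [e]; exact hφ.mem_stabilizer
  refine resOfLe_injective_of_frobenius_generation_of_invariants
    (inertia_adicCompletionPrime_le_decomp v) (fun d hd i hi ↦ ?_) hφD (fun U hU d hd ↦ ?_)
    (E.continuous_smul_geomPrimaryTorsion p)
    (fun m hm ↦ exists_frob_smul_sub_eq_of_inertiaDivisible E p hpv hdiv hφ m hm)
  · rw [e] at hd
    exact inv_mul_mul_mem_inertia_adicCompletionPrime v hd hi
  · rw [e] at hd
    exact exists_eq_frobenius_pow_mul_of_mem_decompositionSubgroup h𝔓₀ hφ hU hd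

/-! ## §3. `H¹_ur(K_v, E[p^∞]) = 0` (cohomology of the completion) under (DIV) -/

/-- **`unramifiedSubgroup (E[p^∞]|_{Γ_{K_v}}) 1 = ⊥` at `v ∤ p` when `E[p^∞]^{I_v}` is `p`-divisible**
(hypothesis in the local form: `I_v = absInertia K_v` acting through `res`).  A class unramified in
`H¹(Γ_{K_v}, E[p^∞])` is principal on `I_{K_v}` (`LocBridge.mem_unramifiedSubgroup_one_iff_exists`),
hence represented by a cocycle VANISHING on `I_{K_v}` (subtract the coboundary), in particular on
`ker (Γ_{K_v} → D_v) ⊆ I_{K_v}`; it descends to `D_v` (`LocBridge.exists_pullback_corestrict_eq`),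
where it vanishes on `I_{𝔓₀} = res I_{K_v}` and is killed by §3.  The good case is the tree's
`LocBridge.unramifiedSubgroup_primary_eq_bot`.
[cite: MilneADT2006, Ch. I §2 (unramified cohomology)] [cite: GreenbergLNM1716, §3 Lemma 3.3 (pp. 86–88)] -/
theorem unramifiedSubgroup_primary_eq_bot_of_inertiaDivisible {v : HeightOneSpectrum (𝓞 K)}
    (hpv : (p : 𝓞 K) ∉ v.asIdeal)
    (hdiv : ∀ t : E.geomPrimaryTorsion p,
      (∀ τ ∈ absInertia (v.adicCompletion K), absGaloisRestrict K (v.adicCompletion K) τ • t = t) →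
      ∃ s : E.geomPrimaryTorsion p,
        (∀ τ ∈ absInertia (v.adicCompletion K), absGaloisRestrict K (v.adicCompletion K) τ • s = s) ∧
          p • s = t) :
    DiscreteGaloisModule.unramifiedSubgroup
      (GaloisRep.restrictField (v.adicCompletion K) (primaryGaloisModule E p)) 1 = ⊥ := by
  haveI : CompactSpace (absoluteGaloisGroup (v.adicCompletion K)) :=
    absoluteGaloisGroup_compactSpace _
  -- (DIV) in the `I_{𝔓₀}`-form
  have hdiv' : ∀ t : E.geomPrimaryTorsion p,
      (∀ i ∈ (adicCompletionPrime K v).inertia (absoluteGaloisGroup K), i • t = t) →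
      ∃ s : E.geomPrimaryTorsion p,
        (∀ i ∈ (adicCompletionPrime K v).inertia (absoluteGaloisGroup K), i • s = s) ∧ p • s = t := by
    intro t ht
    obtain ⟨s, hs, hps⟩ := hdiv t ((forall_inertia_adicCompletionPrime_smul_eq_iff E p v t).mp ht)
    exact ⟨s, (forall_inertia_adicCompletionPrime_smul_eq_iff E p v s).mpr hs, hps⟩
  rw [eq_bot_iff]
  intro c hc
  obtain ⟨ψ, rfl⟩ := oneCocycleClass_surjective _ c
  rw [AddSubgroup.mem_bot]
  -- `ψ` is principal on the local inertia group: `ψ τ = τ w − w`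
  obtain ⟨w, hw⟩ := (mem_unramifiedSubgroup_one_iff_exists _ ψ).mp hc
  -- the coboundary of `w` as a cocycle on `Γ_{K_v}`
  have hcontw : Continuous fun σ : absoluteGaloisGroup (v.adicCompletion K) ↦
      GaloisRep.restrictField (v.adicCompletion K) (primaryGaloisModule E p) σ w :=
    (E.continuous_smul_geomPrimaryTorsion p w).comp (absGaloisRestrict K (v.adicCompletion K)).continuous
  let δ : contOneCocycles (DiscreteGaloisModule.toTopRep
      (GaloisRep.restrictField (v.adicCompletion K) (primaryGaloisModule E p))) :=
    ⟨⟨fun σ ↦ GaloisRep.restrictField (v.adicCompletion K) (primaryGaloisModule E p) σ w - w,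
      hcontw.sub continuous_const⟩, fun g h ↦ by
        change absGaloisRestrict K (v.adicCompletion K) (g * h) • w - w =
          (absGaloisRestrict K (v.adicCompletion K) g • w - w) +
            absGaloisRestrict K (v.adicCompletion K) g • (absGaloisRestrict K (v.adicCompletion K) h • w - w)
        rw [map_mul, mul_smul, smul_sub]
        abel⟩
  have hδ : oneCocycleClass _ δ = 0 := (oneCocycleClass_eq_zero_iff _ δ).mpr ⟨w, fun _ ↦ rfl⟩
  set ψ₁ := ψ - δ with hψ₁
  have hψ₁cls : oneCocycleClass _ ψ₁ = oneCocycleClass _ ψ := by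
    rw [hψ₁, oneCocycleClass_sub, hδ, sub_zero]
  -- `ψ₁` vanishes on the local inertia group
  have hψ₁I : ∀ τ ∈ absInertia (v.adicCompletion K), ψ₁.1 τ = 0 := by
    intro τ hτ
    rw [hψ₁, Submodule.coe_sub, ContinuousMap.sub_apply, hw τ hτ]
    exact sub_self _
  -- hence wherever `res` lands in `I_{𝔓₀}`
  have hψ : ∀ l : absoluteGaloisGroup (v.adicCompletion K),
      absGaloisRestrict K (v.adicCompletion K) l ∈
        (adicCompletionPrime K v).inertia (absoluteGaloisGroup K) → ψ₁.1 l = 0 := by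
    intro l hl
    rw [inertia_adicCompletionPrime_eq_map_absInertia] at hl
    obtain ⟨τ, hτ, hτl⟩ := hl
    have hτl' : absGaloisRestrict K (v.adicCompletion K) τ =
        absGaloisRestrict K (v.adicCompletion K) l := hτl
    have hn : absGaloisRestrict K (v.adicCompletion K) (τ⁻¹ * l) = 1 := by
      rw [map_mul, map_inv, ← hτl', inv_mul_cancel]
    have hnI := mem_absInertia_of_absGaloisRestrict_eq_one v hn
    have h := ψ₁.2 τ (τ⁻¹ * l)
    rw [mul_inv_cancel_left, hψ₁I τ hτ, hψ₁I _ hnI, map_zero, add_zero] at h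
    exact h
  rw [← hψ₁cls]
  exact oneCocycleClass_eq_zero_of_descent (absGaloisRestrict K (v.adicCompletion K)) (decomp v)
    (fun g ↦ (mem_decomp_iff v g).trans ⟨fun ⟨σ, h⟩ ↦ ⟨σ, h⟩, fun ⟨σ, h⟩ ↦ ⟨σ, h⟩⟩)
    (DiscreteGaloisModule.toTopRep
      (GaloisRep.restrictField (v.adicCompletion K) (primaryGaloisModule E p)))
    (TopRep.ofHom ⟨ContinuousLinearMap.id ℤ (E.geomPrimaryTorsion p), fun _ ↦ rfl⟩)
    Function.bijective_id (inertia_adicCompletionPrime_le_decomp v)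
    (resOfLe_inertia_injective_of_inertiaDivisible E p hpv hdiv') ψ₁ hψ

/-! ## §4. (DIV) from local data; the good case re-derived -/

/-- **(DIV) from LOCAL data.**  If every `p`-power torsion point of `E(K̄_v)` fixed by the local
inertia group `absInertia K_v` is `p` times such a point, then (DIV) holds for `E(K̄)[p^∞]` with
`absInertia K_v` acting through `res`: the torsion of `E(K̄_v)` comes from `E(K̄)` along the chosen
embedding (`exists_pointsMapOfEmb_eq_of_nsmul_eq_zero`, Silverman III.6.4), equivariantly
(`pointsMap_smul`) and injectively. [cite: SilvermanAEC2009, Cor. III.6.4(b)] -/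
theorem inertiaDivisible_of_localPoints {v : HeightOneSpectrum (𝓞 K)}
    (hloc : ∀ P : localPoints E (v.adicCompletion K),
      (∀ τ ∈ absInertia (v.adicCompletion K), τ • P = P) → (∃ k : ℕ, p ^ k • P = 0) →
      ∃ S : localPoints E (v.adicCompletion K),
        (∀ τ ∈ absInertia (v.adicCompletion K), τ • S = S) ∧ p • S = P)
    (t : E.geomPrimaryTorsion p)
    (ht : ∀ τ ∈ absInertia (v.adicCompletion K), absGaloisRestrict K (v.adicCompletion K) τ • t = t) :
    ∃ s : E.geomPrimaryTorsion p,
      (∀ τ ∈ absInertia (v.adicCompletion K), absGaloisRestrict K (v.adicCompletion K) τ • s = s) ∧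
        p • s = t := by
  set ι := closureEmb (K := K) (v.adicCompletion K) with hι
  have hsmul : ∀ (σ : absoluteGaloisGroup (v.adicCompletion K)) (P : E.geomPoints),
      pointsMapOfEmb E ι (absGaloisRestrict K (v.adicCompletion K) σ • P) = σ • pointsMapOfEmb E ι P :=
    fun σ P ↦ by
      rw [← WeierstrassCurve.resGal_eq_absGaloisRestrict]
      exact pointsMap_smul E (v.adicCompletion K) σ P
  -- the local image `P` of `t`: inertia-fixed `p`-power torsion
  obtain ⟨k, hk⟩ := (AddCommGroup.mem_primaryComponent).mp t.2
  have hPfix : ∀ τ ∈ absInertia (v.adicCompletion K),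
      τ • pointsMapOfEmb E ι (t : E.geomPoints) = pointsMapOfEmb E ι (t : E.geomPoints) := by
    intro τ hτ
    rw [← hsmul, ← primaryComponent.coe_smul, ht τ hτ]
  have hPtor : ∃ k : ℕ, p ^ k • pointsMapOfEmb E ι (t : E.geomPoints) = 0 :=
    ⟨k, by rw [← map_nsmul, hk, map_zero]⟩
  obtain ⟨S, hSfix, hSp⟩ := hloc _ hPfix hPtor
  -- `S` is `p^(k+1)`-torsion, hence algebraic
  have hSk : p ^ (k + 1) • S = 0 := by
    rw [pow_succ, mul_nsmul', hSp, ← map_nsmul, hk, map_zero]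
  obtain ⟨s₀, hs₀k, hs₀⟩ := exists_pointsMapOfEmb_eq_of_nsmul_eq_zero E ι
    (pow_ne_zero (k + 1) (Fact.out : p.Prime).ne_zero) hSk
  refine ⟨⟨s₀, (AddCommGroup.mem_primaryComponent).mpr ⟨k + 1, hs₀k⟩⟩, fun τ hτ ↦ ?_, ?_⟩
  · apply Subtype.ext
    rw [primaryComponent.coe_smul]
    apply pointsMapOfEmb_injective E ι
    change pointsMapOfEmb E ι (absGaloisRestrict K (v.adicCompletion K) τ • s₀) = pointsMapOfEmb E ι s₀
    rw [hsmul, hs₀, hSfix τ hτ]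
  · apply Subtype.ext
    apply pointsMapOfEmb_injective E ι
    rw [AddSubmonoidClass.coe_nsmul, map_nsmul]
    change p • pointsMapOfEmb E ι s₀ = _
    rw [hs₀, hSp]


/-- (DIV) holds at a GOOD place `v ∤ p`: the local inertia group acts trivially on `E[p^∞]`
(Silverman VII.4.1, tree `LocBridge.smul_geomPrimaryTorsion_eq_of_mem_absInertia`) and `E[p^∞]` is
`p`-divisible (`E(K̄)` divisible, `zsmul_geomPoints_surjective_holds`). [cite: SilvermanAEC2009, Prop. VII.4.1(a)] -/
theorem inertiaDivisible_of_hasGoodReductionAt {v : HeightOneSpectrum (𝓞 K)}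
    (hpv : (p : 𝓞 K) ∉ v.asIdeal) (hv : E.HasGoodReductionAt v) (t : E.geomPrimaryTorsion p)
    (_ht : ∀ τ ∈ absInertia (v.adicCompletion K), absGaloisRestrict K (v.adicCompletion K) τ • t = t) :
    ∃ s : E.geomPrimaryTorsion p,
      (∀ τ ∈ absInertia (v.adicCompletion K), absGaloisRestrict K (v.adicCompletion K) τ • s = s) ∧
        p • s = t := by
  obtain ⟨s, hs⟩ := E.exists_nsmul_eq_geomPrimaryTorsion p E.zsmul_geomPoints_surjective_holds t
  exact ⟨s, fun τ hτ ↦ smul_geomPrimaryTorsion_eq_of_mem_absInertia E p hpv hv hτ s, hs⟩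

/-- The tree's good case as the special case of §4: `H¹_ur(K_v, E[p^∞]) = 0` at every good `v ∤ p`
(= `LocBridge.unramifiedSubgroup_primary_eq_bot`, re-derived). [cite: GreenbergLNM1716, §3 Lemma 3.3 (good case)] -/
theorem unramifiedSubgroup_primary_eq_bot_of_hasGoodReductionAt' {v : HeightOneSpectrum (𝓞 K)}
    (hpv : (p : 𝓞 K) ∉ v.asIdeal) (hv : E.HasGoodReductionAt v) :
    DiscreteGaloisModule.unramifiedSubgroup
      (GaloisRep.restrictField (v.adicCompletion K) (primaryGaloisModule E p)) 1 = ⊥ :=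
  unramifiedSubgroup_primary_eq_bot_of_inertiaDivisible E p hpv
    (fun t ht ↦ inertiaDivisible_of_hasGoodReductionAt E p hpv hv t ht)

end Curve

end Summit.BirchSwinnertonDyer.Rank1Residual.GaloisImage.InertiaDivisible

end
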